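import Literature.Barriers.NavierStokesRegularity.NavierStokesInequalityProfileMargin
import HarnessLib

/-!
# The damped profiles `hᵢ,ₜ = √(fᵢ² - 2tδφᵢ)` of Ożański's Lemma 4.1 (Scheffer 1985, Lemma 3.1)

Barrier catalogue support file for `NavierStokesRegularity` (D-0021), on the discharge path of
fact D-II `Literature.Barriers.NavierStokesRegularity.NSIProfiles_of_arrangement`
(`NavierStokesInequalityProfiles`): W. S. Ożański, arXiv:1709.00602v4, §4, (4.13)–(4.14) and
**Lemma 4.1** (held rendering: Lemma 8); V. Scheffer, Comm. Math. Phys. 101 (1985), **Lemma 3.1**,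
(3.8)–(3.15). Given a structure `(v, f, φ)` on `U` the time-dependent modification
`h_t² = f² - 2tδφ` ((4.13); Scheffer (3.11): `h₁(x,t) = (f₁(x)² - 2tδg₁(x))^{1/2}`) is, for
`δ > 0` small, again an admissible profile: "`h₁ ∈ C^∞(P × (-δ, T+δ); [0,∞))`",
"`h₁,ₜ > |v₁| ≥ 0` in `U₁` for `t ∈ (-δ, T+δ)`", `h₁,ₜ = f₁` outside `supp φ₁`, and
`∂ₜh²₁,ₜ = -2δφ₁` (the source of the slack `-2δφᵢ` in (4.18) and §4.2). The same formula gives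
`h₂,ₜ` and `qᵏᵢ,ₜ` of (4.14), (4.16) off `{φᵢ = 1}` (there `vᵢ = 0`). This file defines
`dampedProfile f φ δ t = √(f² - 2tδφ)` and PROVES, for a structure and `T > 0`, for all
`δ ∈ [0, δ₀]` (`δ₀ > 0` depending on the structure and `T`) and `t ∈ [-1, T+1]`:

* `dampedProfile_zero` (`h₀ = f`), `dampedProfile_nonneg`, `dampedProfile_eq_of_notMem`
  (`h_t = f` off `supp φ`), `dampedProfile_eq_zero` (`h_t = 0` off `Ū`);
* `exists_dampedProfile_gap` — **`h_t² - |v|² ≥ m > 0` on `supp φ`**, whence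
  `sq_lt_dampedProfile_sq` — **`h_t > |v|` on `U`** (Ożański: "`δ < min_{supp φ₁}|f₁² -
  |v₁|²|/2(T+2)` to obtain `h₁,ₜ > |v₁|` in `supp φ₁` for `t ∈ [-1,T+1]`"; Scheffer (3.12));
* `contDiffOn_dampedProfile` — **`h ∈ C^∞((-1,T+1) × ℝ²)`** (positive radicand on `U`, `= f`
  near points off `supp φ`; Scheffer (3.10));
* `deriv_dampedProfile_sq` — **`∂ₜ(h_t²)(q) = -2δφ(q)`** ((4.18) with `vᵢ = 0`; Scheffer (3.13));
* `tsupport_dampedProfile` — `supp h_t = Ū`;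
* `dampedProfile_mul_opL_nonneg` — **`h_t L(h_t) ≥ 0` on `P ∖ {φ > θ}`**, `t ∈ [0,T]`, any
  `θ < 1` (Scheffer (3.15): "`L(hᵢ,ₜ) ≥ 0` where `gᵢ < 1`"; the tree's `exists_opL_sqrt_ge`);
* `isNSIStructure_dampedProfile` — **`(a v, h_t, ψ)` is a structure on `U`** for `|a| ≤ 1`,
  `t ∈ [0,T]`, with the STEEPENED cut-off `ψ = ρ ∘ φ`, `ρ(s) = smoothTransition(2s/θ - 1)`
  (`ψ = 1` on `{φ ≥ θ} ⊇ supp v`, `supp ψ ⊆ supp φ`): the printed claim (4.15)/(4.20) that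
  `(a vᵢ, hᵢ,ₜ, φᵢ)` is a structure asks for `L hᵢ,ₜ > 0` on all of `Uᵢ ∖ {φᵢ = 1}`, for which a
  general structure in the sense of Definition 3.3 offers no margin near `∂{φᵢ = 1}`; with `ψ`
  in place of `φᵢ` only `L hᵢ,ₜ > 0` on `Uᵢ ∩ {φᵢ < θ}` is needed, which `exists_opL_sqrt_ge`
  provides. This is the form in which the continuity lemma of Appendix A
  (`NavierStokesInequalityPressureContinuity`, stated for pairs of structures with a common
  planar field) applies to `(a vᵢ, hᵢ,ₜ)` and `(a vᵢ, fᵢ)`.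

## References

* W. S. Ożański, arXiv:1709.00602v4, §4 (4.13)–(4.15), Lemma 4.1 and its proof, (4.18)–(4.20).
  [`Ozanski2017NSISingular`]
* V. Scheffer, Comm. Math. Phys. 101 (1985), Lemma 3.1, (3.8)–(3.15), pp. 57–58.
  [`Scheffer1985`]
-/

noncomputable section

open Set Function Filter Topology TopologicalSpace Metric
open scoped ContDiff

namespace Literature.Barriers.NavierStokesRegularity

open Literature.Analysis.FluidPDE

/-- **The damped profile** `h_t = √(f² - 2tδφ)` of a structure `(v,f,φ)` (Ożański (4.13):
`h²₁,ₜ := f₁² - 2tδφ₁`; Scheffer 1985, (3.11)), time first: `dampedProfile f φ δ t q`.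
[cite: Ozanski2017NSISingular, §4 (4.13)] [cite: Scheffer1985, Lemma 3.1 (3.11)] -/
def dampedProfile (f φ : ℝ × ℝ → ℝ) (δ t : ℝ) (q : ℝ × ℝ) : ℝ :=
  Real.sqrt (f q ^ 2 - 2 * t * δ * φ q)

/-- Unfolding `dampedProfile`. [folklore] -/
theorem dampedProfile_apply (f φ : ℝ × ℝ → ℝ) (δ t : ℝ) (q : ℝ × ℝ) :
    dampedProfile f φ δ t q = Real.sqrt (f q ^ 2 - 2 * t * δ * φ q) := rfl

/-- The slice at time `t` as a function of `q`, in the form of `NavierStokesInequalityProfileMargin`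
(`ε = 2tδ`). [folklore] -/
theorem dampedProfile_eq_sqrt (f φ : ℝ × ℝ → ℝ) (δ t : ℝ) :
    dampedProfile f φ δ t = fun q => Real.sqrt (f q ^ 2 - (2 * t * δ) * φ q) := rfl

/-- `h_t ≥ 0`. [cite: Ozanski2017NSISingular, Lemma 4.1] -/
theorem dampedProfile_nonneg (f φ : ℝ × ℝ → ℝ) (δ t : ℝ) (q : ℝ × ℝ) :
    0 ≤ dampedProfile f φ δ t q :=
  Real.sqrt_nonneg _

/-- `|a w|² ≤ |w|²` for `|a| ≤ 1` (planar Euclidean length written out). [folklore] -/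
theorem smul_sq_le {a : ℝ} (ha : |a| ≤ 1) (w : ℝ × ℝ) :
    (a • w).1 ^ 2 + (a • w).2 ^ 2 ≤ w.1 ^ 2 + w.2 ^ 2 := by
  have ha2 : a ^ 2 ≤ 1 := by
    have := abs_le.1 ha
    nlinarith
  have hnn : 0 ≤ w.1 ^ 2 + w.2 ^ 2 := by positivity
  calc (a • w).1 ^ 2 + (a • w).2 ^ 2 = a ^ 2 * (w.1 ^ 2 + w.2 ^ 2) := by simp; ring
    _ ≤ 1 * (w.1 ^ 2 + w.2 ^ 2) := mul_le_mul_of_nonneg_right ha2 hnn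
    _ = w.1 ^ 2 + w.2 ^ 2 := one_mul _

namespace IsNSIStructure

variable {U : Set (ℝ × ℝ)} {v : ℝ × ℝ → ℝ × ℝ} {f φ : ℝ × ℝ → ℝ}

/-- **`h₀ = f`** (so `qᵏᵢ,₀ = hᵢ,₀ = fᵢ`, Ożański §4.2: `|u(x,0,0)| = f₁ + f₂`).
[cite: Ozanski2017NSISingular, §4.2 (claim (ii))] -/
theorem dampedProfile_zero (h : IsNSIStructure U v f φ) (δ : ℝ) : dampedProfile f φ δ 0 = f := by
  funext q
  rw [dampedProfile_apply, mul_zero, zero_mul, zero_mul, sub_zero, Real.sqrt_sq (h.f_nonneg q)]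

/-- **`h_t = f` off `supp φ`** ("`hᵢ,ₜ = fᵢ` outside `supp φᵢ`", Ożański after (4.14); Scheffer
(3.11): `hᵢ(x,t) = fᵢ(x)` if `x ∉ spt(gᵢ)`). [cite: Ozanski2017NSISingular, §4 (after (4.14))] -/
theorem dampedProfile_eq_of_notMem (h : IsNSIStructure U v f φ) (δ t : ℝ) {q : ℝ × ℝ}
    (hq : q ∉ tsupport φ) : dampedProfile f φ δ t q = f q := by
  rw [dampedProfile_apply, image_eq_zero_of_notMem_tsupport hq, mul_zero, sub_zero,
    Real.sqrt_sq (h.f_nonneg q)]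

/-- Jointly in `(t, q)`: near a point `(t₀, q₀)` with `q₀ ∉ supp φ`, `h_t(q) = f(q)`. [folklore] -/
theorem dampedProfile_eventuallyEq_of_notMem (h : IsNSIStructure U v f φ) (δ t₀ : ℝ) {q₀ : ℝ × ℝ}
    (hq : q₀ ∉ tsupport φ) :
    uncurry (dampedProfile f φ δ) =ᶠ[𝓝 (t₀, q₀)] fun p => f p.2 := by
  have hO : IsOpen ((univ : Set ℝ) ×ˢ (tsupport φ)ᶜ) :=
    isOpen_univ.prod (isClosed_tsupport φ).isOpen_compl
  filter_upwards [hO.mem_nhds ⟨mem_univ _, hq⟩] with p hp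
  exact h.dampedProfile_eq_of_notMem δ p.1 hp.2

/-- **`h_t = 0` off `Ū`** (all data vanish there). [cite: Ozanski2017NSISingular, Lemma 4.1] -/
theorem dampedProfile_eq_zero (h : IsNSIStructure U v f φ) (δ t : ℝ) {q : ℝ × ℝ}
    (hq : q ∉ closure U) : dampedProfile f φ δ t q = 0 := by
  have hφ : q ∉ tsupport φ := fun h' => hq (subset_closure (h.tsupport_φ h'))
  rw [h.dampedProfile_eq_of_notMem δ t hφ, h.f_eq_zero hq]

/-! ### The positivity margin and `h_t > |v|` -/

/-- **The gap `h_t² - |v|² ≥ m > 0` on `supp φ`** for `δ ∈ [0, δ₀]`, `t ∈ [-1, T+1]` (Ożański,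
proof of Lemma 4.1: "`δ < min_{supp φ₁}|f₁² - |v₁|²|/2(T+2)`"; Scheffer (3.12)); here also the
radicand identity `h_t² = f² - 2tδφ`. [cite: Ozanski2017NSISingular, Lemma 4.1 (proof)] -/
theorem exists_dampedProfile_gap (h : IsNSIStructure U v f φ) {T : ℝ} (hT : 0 < T) :
    ∃ m > 0, ∃ δ₀ > 0, ∀ δ ∈ Icc (0 : ℝ) δ₀, ∀ t ∈ Icc (-1 : ℝ) (T + 1), ∀ q ∈ tsupport φ,
      (v q).1 ^ 2 + (v q).2 ^ 2 + m ≤ f q ^ 2 - 2 * t * δ * φ q := by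
  obtain ⟨m, hm, ε₀, hε₀, hgap⟩ := h.exists_sqrt_sq_gap
  obtain ⟨m₀, hm₀, hgap₀⟩ := h.exists_sq_gap
  refine ⟨min m m₀, lt_min hm hm₀, ε₀ / (2 * (T + 1)), by positivity, fun δ hδ t ht q hq => ?_⟩
  have hφ := h.φ_mem q
  rcases le_or_gt 0 t with ht0 | ht0
  · -- `t ≥ 0`: `ε = 2tδ ∈ [0, ε₀]`
    have hε : 2 * t * δ ∈ Icc (0 : ℝ) ε₀ := by
      refine ⟨by nlinarith [hδ.1], ?_⟩
      have h1 : 2 * t * δ ≤ 2 * (T + 1) * (ε₀ / (2 * (T + 1))) := by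
        apply mul_le_mul (by linarith [ht.2]) hδ.2 hδ.1 (by linarith)
      rwa [mul_div_cancel₀ _ (by positivity : (2 * (T + 1) : ℝ) ≠ 0)] at h1
    have := hgap _ hε q hq
    have hmin := min_le_left m m₀
    linarith
  · -- `t < 0`: the radicand is at least `f²`
    have h1 := hgap₀ q hq
    have h2 : 0 ≤ -(2 * t * δ * φ q) := by
      have := mul_nonneg (mul_nonneg (show (0 : ℝ) ≤ -t by linarith) hδ.1) hφ.1
      linarith
    have hmin := min_le_right m m₀
    linarith

/-- The radicand is nonnegative everywhere, for `δ ∈ [0, δ₀]`, `t ∈ [-1, T+1]`. [folklore] -/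
theorem exists_dampedProfile_radicand_nonneg (h : IsNSIStructure U v f φ) {T : ℝ} (hT : 0 < T) :
    ∃ δ₀ > 0, ∀ δ ∈ Icc (0 : ℝ) δ₀, ∀ t ∈ Icc (-1 : ℝ) (T + 1), ∀ q : ℝ × ℝ,
      0 ≤ f q ^ 2 - 2 * t * δ * φ q := by
  obtain ⟨m, hm, δ₀, hδ₀, hgap⟩ := h.exists_dampedProfile_gap hT
  refine ⟨δ₀, hδ₀, fun δ hδ t ht q => ?_⟩
  by_cases hq : q ∈ tsupport φ
  · have := hgap δ hδ t ht q hq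
    nlinarith [sq_nonneg (v q).1, sq_nonneg (v q).2]
  · rw [image_eq_zero_of_notMem_tsupport hq, mul_zero, sub_zero]
    exact sq_nonneg _

/-- **`h_t > |v|` on `U`** for `δ ∈ [0, δ₀]`, `t ∈ [-1, T+1]` ("`h₁,ₜ > |v₁| ≥ 0` in `U₁` for
`t ∈ (-δ, T+δ)`", Ożański, proof of Lemma 4.1; Scheffer (3.12): `hᵢ(x,t) > |vᵢ(x)|` if
`x ∈ spt gᵢ`), together with the gap on `supp φ` and the radicand identity.
[cite: Ozanski2017NSISingular, Lemma 4.1 (proof)] [cite: Scheffer1985, Lemma 3.1 (3.12)] -/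
theorem exists_sq_lt_dampedProfile_sq (h : IsNSIStructure U v f φ) {T : ℝ} (hT : 0 < T) :
    ∃ δ₀ > 0, ∀ δ ∈ Icc (0 : ℝ) δ₀, ∀ t ∈ Icc (-1 : ℝ) (T + 1), ∀ q ∈ U,
      (v q).1 ^ 2 + (v q).2 ^ 2 < dampedProfile f φ δ t q ^ 2 := by
  obtain ⟨m, hm, δ₀, hδ₀, hgap⟩ := h.exists_dampedProfile_gap hT
  refine ⟨δ₀, hδ₀, fun δ hδ t ht q hq => ?_⟩
  by_cases hφ : q ∈ tsupport φ
  · have h1 := hgap δ hδ t ht q hφ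
    have h0 : 0 ≤ f q ^ 2 - 2 * t * δ * φ q := by
      nlinarith [sq_nonneg (v q).1, sq_nonneg (v q).2]
    rw [dampedProfile_apply, Real.sq_sqrt h0]
    linarith
  · rw [h.dampedProfile_eq_of_notMem δ t hφ]
    exact h.sq_lt q hq

/-! ### Smoothness, time derivative, support -/

/-- **`h ∈ C^∞((-1, T+1) × ℝ²)`** for `δ ∈ [0, δ₀]` (Ożański Lemma 4.1: "`h₁ ∈ C^∞(P × (-δ,T+δ);
[0,∞))`"; Scheffer (3.10)): on `U` the radicand is positive, off `supp φ` the profile is `f`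
near the point. [cite: Ozanski2017NSISingular, Lemma 4.1] [cite: Scheffer1985, Lemma 3.1 (3.10)] -/
theorem exists_contDiffOn_dampedProfile (h : IsNSIStructure U v f φ) {T : ℝ} (hT : 0 < T) :
    ∃ δ₀ > 0, ∀ δ ∈ Icc (0 : ℝ) δ₀,
      ContDiffOn ℝ ∞ (uncurry (dampedProfile f φ δ)) (Ioo (-1 : ℝ) (T + 1) ×ˢ univ) := by
  obtain ⟨δ₀, hδ₀, hlt⟩ := h.exists_sq_lt_dampedProfile_sq hT
  refine ⟨δ₀, hδ₀, fun δ hδ => ?_⟩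
  rintro ⟨t, q⟩ ⟨ht, -⟩
  have hrad : ContDiff ℝ ∞ fun p : ℝ × (ℝ × ℝ) => f p.2 ^ 2 - 2 * p.1 * δ * φ p.2 :=
    ((h.f_smooth.comp contDiff_snd).pow 2).sub
      (((contDiff_const.mul contDiff_fst).mul contDiff_const).mul (h.φ_smooth.comp contDiff_snd))
  by_cases hq : q ∈ U
  · -- positive radicand: `h_t(q)² > |v(q)|² ≥ 0`
    have hpos : 0 < f q ^ 2 - 2 * t * δ * φ q := by
      have h1 := hlt δ hδ t (Ioo_subset_Icc_self ht) q hq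
      have h2 : 0 ≤ (v q).1 ^ 2 + (v q).2 ^ 2 := by positivity
      have h3 : 0 < dampedProfile f φ δ t q ^ 2 := lt_of_le_of_lt h2 h1
      rw [dampedProfile_apply] at h3
      by_contra hle
      rw [Real.sqrt_eq_zero'.2 (not_lt.1 hle)] at h3
      simp at h3
    have hc : ContDiffAt ℝ ∞ (uncurry (dampedProfile f φ δ)) (t, q) :=
      (hrad.contDiffAt.sqrt hpos.ne').congr_of_eventuallyEq (Eventually.of_forall fun p => rfl)
    exact hc.contDiffWithinAt
  · have hφ : q ∉ tsupport φ := fun h' => hq (h.tsupport_φ h')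
    have hc : ContDiffAt ℝ ∞ (uncurry (dampedProfile f φ δ)) (t, q) :=
      (h.f_smooth.comp contDiff_snd).contDiffAt.congr_of_eventuallyEq
        (h.dampedProfile_eventuallyEq_of_notMem δ t hφ)
    exact hc.contDiffWithinAt

/-- **`∂ₜ(h_t²)(q) = -2δφ(q)`** for `t ∈ (-1, T+1)`, `δ ∈ [0, δ₀]` ((4.18) with `vᵢ = 0`:
`∂ₜ(qᵏᵢ,ₜ)² = -2δφᵢ`; Scheffer (3.13)). [cite: Ozanski2017NSISingular, §4.1 (4.18)] -/
theorem exists_deriv_dampedProfile_sq (h : IsNSIStructure U v f φ) {T : ℝ} (hT : 0 < T) :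
    ∃ δ₀ > 0, ∀ δ ∈ Icc (0 : ℝ) δ₀, ∀ t ∈ Ioo (-1 : ℝ) (T + 1), ∀ q : ℝ × ℝ,
      deriv (fun s => dampedProfile f φ δ s q ^ 2) t = -(2 * δ * φ q) := by
  obtain ⟨δ₀, hδ₀, hnn⟩ := h.exists_dampedProfile_radicand_nonneg hT
  refine ⟨δ₀, hδ₀, fun δ hδ t ht q => ?_⟩
  have he : (fun s => dampedProfile f φ δ s q ^ 2) =ᶠ[𝓝 t]
      fun s => f q ^ 2 - (2 * δ * φ q) * s := by
    filter_upwards [Ioo_mem_nhds ht.1 ht.2] with s hs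
    rw [dampedProfile_apply, Real.sq_sqrt (hnn δ hδ s (Ioo_subset_Icc_self hs) q)]
    ring
  rw [he.deriv_eq]
  have hd : HasDerivAt (fun s => f q ^ 2 - (2 * δ * φ q) * s) (-(2 * δ * φ q)) t := by
    simpa using ((hasDerivAt_id t).const_mul (2 * δ * φ q)).const_sub (f q ^ 2)
  exact hd.deriv

/-- **`supp h_t = Ū`** for `δ ∈ [0, δ₀]`, `t ∈ [-1, T+1]` (`h_t > 0` on `U`, `= 0` off `Ū`).
[cite: Ozanski2017NSISingular, Lemma 4.1] -/
theorem exists_tsupport_dampedProfile (h : IsNSIStructure U v f φ) {T : ℝ} (hT : 0 < T) :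
    ∃ δ₀ > 0, ∀ δ ∈ Icc (0 : ℝ) δ₀, ∀ t ∈ Icc (-1 : ℝ) (T + 1),
      tsupport (dampedProfile f φ δ t) = closure U := by
  obtain ⟨δ₀, hδ₀, hlt⟩ := h.exists_sq_lt_dampedProfile_sq hT
  refine ⟨δ₀, hδ₀, fun δ hδ t ht => ?_⟩
  apply Subset.antisymm
  · refine closure_minimal (fun q hq => ?_) isClosed_closure
    by_contra hq'
    exact hq (h.dampedProfile_eq_zero δ t hq')
  · refine closure_mono fun q hq => mem_support.2 fun h0 => ?_
    have h1 := hlt δ hδ t ht q hq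
    rw [h0] at h1
    nlinarith [sq_nonneg (v q).1, sq_nonneg (v q).2]

/-! ### The `L`-condition and the steepened cut-off -/

/-- **`h_t L(h_t) ≥ 0` on `P ∖ {φ > θ}`** for `t ∈ [0,T]`, `δ ∈ [0, δ₀]`, any `θ < 1` (Scheffer
(3.15): "`L(hᵢ,ₜ) ≥ 0` where `gᵢ < 1`"; here from `exists_sqrt_mul_opL_sqrt_nonneg` with
`ε = 2tδ`). [cite: Scheffer1985, Lemma 3.1 (3.15)] [cite: Ozanski2017NSISingular, Lemma 4.1] -/
theorem exists_dampedProfile_mul_opL_nonneg (h : IsNSIStructure U v f φ) {T : ℝ} (hT : 0 < T)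
    {θ : ℝ} (hθ : θ < 1) :
    ∃ δ₀ > 0, ∀ δ ∈ Icc (0 : ℝ) δ₀, ∀ t ∈ Icc (0 : ℝ) T, ∀ q : ℝ × ℝ, φ q ≤ θ → 0 < q.1 →
      0 ≤ dampedProfile f φ δ t q * opL (dampedProfile f φ δ t) q := by
  obtain ⟨ε₀, hε₀, hL⟩ := h.exists_sqrt_mul_opL_sqrt_nonneg hθ
  refine ⟨ε₀ / (2 * T), by positivity, fun δ hδ t ht q hφq hq1 => ?_⟩
  have hε : 2 * t * δ ∈ Icc (0 : ℝ) ε₀ := by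
    refine ⟨by nlinarith [hδ.1, ht.1], ?_⟩
    have h1 : 2 * t * δ ≤ 2 * T * (ε₀ / (2 * T)) :=
      mul_le_mul (by linarith [ht.2]) hδ.2 hδ.1 (by linarith)
    rwa [mul_div_cancel₀ _ (by positivity : (2 * T : ℝ) ≠ 0)] at h1
  rw [dampedProfile_eq_sqrt]
  exact hL _ hε q hφq hq1

/-- **`L(h_t) ≥ c₀ > 0` on `supp φ ∩ {φ ≤ θ}`** for `t ∈ [0,T]`, `δ ∈ [0, δ₀]`.
[cite: Scheffer1985, Lemma 3.1 (3.15)] [cite: Ozanski2017NSISingular, Lemma 4.1] -/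
theorem exists_opL_dampedProfile_ge (h : IsNSIStructure U v f φ) {T : ℝ} (hT : 0 < T)
    {θ : ℝ} (hθ : θ < 1) :
    ∃ c₀ > 0, ∃ δ₀ > 0, ∀ δ ∈ Icc (0 : ℝ) δ₀, ∀ t ∈ Icc (0 : ℝ) T, ∀ q ∈ tsupport φ, φ q ≤ θ →
      c₀ ≤ opL (dampedProfile f φ δ t) q := by
  obtain ⟨c₀, hc₀, ε₀, hε₀, hL⟩ := h.exists_opL_sqrt_ge hθ
  refine ⟨c₀, hc₀, ε₀ / (2 * T), by positivity, fun δ hδ t ht q hq hφq => ?_⟩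
  have hε : 2 * t * δ ∈ Icc (0 : ℝ) ε₀ := by
    refine ⟨by nlinarith [hδ.1, ht.1], ?_⟩
    have h1 : 2 * t * δ ≤ 2 * T * (ε₀ / (2 * T)) :=
      mul_le_mul (by linarith [ht.2]) hδ.2 hδ.1 (by linarith)
    rwa [mul_div_cancel₀ _ (by positivity : (2 * T : ℝ) ≠ 0)] at h1
  rw [dampedProfile_eq_sqrt]
  exact hL _ hε q hq hφq

/-- **The steepened cut-off** `ψ = ρ ∘ φ`, `ρ(s) = smoothTransition(2s/θ - 1)`: smooth,
`[0,1]`-valued, `= 1` on `{φ ≥ θ}`, `= 0` on `{φ ≤ θ/2}` (so `supp ψ ⊆ supp φ`). [folklore] -/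
theorem steepCutoff_props (h : IsNSIStructure U v f φ) {θ : ℝ} (hθ : 0 < θ) :
    ContDiff ℝ ∞ (fun q => Real.smoothTransition (2 * φ q / θ - 1)) ∧
      (∀ q, Real.smoothTransition (2 * φ q / θ - 1) ∈ Icc (0 : ℝ) 1) ∧
      (∀ q, θ ≤ φ q → Real.smoothTransition (2 * φ q / θ - 1) = 1) ∧
      (∀ q, φ q ≤ θ / 2 → Real.smoothTransition (2 * φ q / θ - 1) = 0) := by
  refine ⟨Real.smoothTransition.contDiff.comp (((contDiff_const.mul h.φ_smooth).div_const θ).sub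
    contDiff_const), fun q => ⟨Real.smoothTransition.nonneg _, Real.smoothTransition.le_one _⟩,
    fun q hq => Real.smoothTransition.one_of_one_le ?_,
    fun q hq => Real.smoothTransition.zero_of_nonpos ?_⟩
  · rw [le_sub_iff_add_le, le_div_iff₀ hθ]
    linarith
  · rw [sub_nonpos, div_le_one hθ]
    linarith

/-- **`(a v, h_t, ψ)` is a structure on `U`** for `|a| ≤ 1`, `t ∈ [0,T]`, `δ ∈ [0, δ₀]`, with the
steepened cut-off `ψ = smoothTransition(2φ/θ - 1)`, `0 < θ < 1` (the usable form of Ożański's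
(4.15)/(4.20) "`(a vᵢ, hᵢ,ₜ, φᵢ)` is a structure on `Uᵢ`": `Lh_t > 0` is available on
`U ∩ {φ < θ} ⊇ U ∖ {ψ = 1}` — `≥ c₀` on `supp φ ∩ {φ ≤ θ}`, `= Lf > 0` off `supp φ` — and
`supp(a v) ⊆ {φ = 1} ⊆ {ψ = 1}`, `supp ψ ⊆ supp φ ⊆ U`).
[cite: Ozanski2017NSISingular, §4 (4.15) and (4.20)] [cite: Scheffer1985, Lemma 3.1 (3.8)–(3.15)] -/
theorem exists_isNSIStructure_dampedProfile (h : IsNSIStructure U v f φ) {T : ℝ} (hT : 0 < T)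
    {θ : ℝ} (hθ0 : 0 < θ) (hθ1 : θ < 1) :
    ∃ δ₀ > 0, ∀ δ ∈ Icc (0 : ℝ) δ₀, ∀ t ∈ Icc (0 : ℝ) T, ∀ a : ℝ, |a| ≤ 1 →
      IsNSIStructure U (a • v) (dampedProfile f φ δ t)
        (fun q => Real.smoothTransition (2 * φ q / θ - 1)) := by
  obtain ⟨δ₁, hδ₁, hlt⟩ := h.exists_sq_lt_dampedProfile_sq hT
  obtain ⟨δ₂, hδ₂, hsmooth⟩ := h.exists_contDiffOn_dampedProfile hT
  obtain ⟨δ₃, hδ₃, hsupp⟩ := h.exists_tsupport_dampedProfile hT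
  obtain ⟨c₀, hc₀, δ₄, hδ₄, hL⟩ := h.exists_opL_dampedProfile_ge hT hθ1
  obtain ⟨hψs, hψm, hψ1, hψ0⟩ := h.steepCutoff_props hθ0
  refine ⟨min (min δ₁ δ₂) (min δ₃ δ₄), lt_min (lt_min hδ₁ hδ₂) (lt_min hδ₃ hδ₄),
    fun δ hδ t ht a ha => ?_⟩
  have hδ1 : δ ∈ Icc (0 : ℝ) δ₁ := ⟨hδ.1, hδ.2.trans ((min_le_left _ _).trans (min_le_left _ _))⟩
  have hδ2 : δ ∈ Icc (0 : ℝ) δ₂ := ⟨hδ.1, hδ.2.trans ((min_le_left _ _).trans (min_le_right _ _))⟩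
  have hδ3 : δ ∈ Icc (0 : ℝ) δ₃ := ⟨hδ.1, hδ.2.trans ((min_le_right _ _).trans (min_le_left _ _))⟩
  have hδ4 : δ ∈ Icc (0 : ℝ) δ₄ := ⟨hδ.1, hδ.2.trans ((min_le_right _ _).trans (min_le_right _ _))⟩
  have htI : t ∈ Icc (-1 : ℝ) (T + 1) := ⟨by linarith [ht.1], by linarith [ht.2]⟩
  have htO : t ∈ Ioo (-1 : ℝ) (T + 1) := ⟨by linarith [ht.1], by linarith [ht.2]⟩
  have hav := h.smul ha
  -- `supp ψ ⊆ supp φ`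
  have hψsupp : tsupport (fun q => Real.smoothTransition (2 * φ q / θ - 1)) ⊆ tsupport φ := by
    refine closure_mono fun q hq => ?_
    rw [mem_support] at hq ⊢
    intro h0
    exact hq (hψ0 q (by rw [h0]; positivity))
  exact
    { isOpen := h.isOpen
      isCompact_closure := h.isCompact_closure
      closure_subset := h.closure_subset
      v_smooth := hav.v_smooth
      f_smooth := IsSmoothSpaceTimeOn.contDiff_slice (hsmooth δ hδ2) htO
      φ_smooth := hψs
      f_nonneg := fun q => dampedProfile_nonneg f φ δ t q
      φ_mem := hψm
      tsupport_f := hsupp δ hδ3 t htI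
      tsupport_φ := hψsupp.trans h.tsupport_φ
      tsupport_v := fun q hq => hψ1 q (by rw [hav.tsupport_v hq]; exact hθ1.le)
      div_eq_zero := hav.div_eq_zero
      sq_lt := fun q hq => (smul_sq_le ha (v q)).trans_lt (hlt δ hδ1 t htI q hq)
      opL_pos := fun q hq hψq => by
        have hφθ : φ q < θ := lt_of_not_ge fun h' => hψq (hψ1 q h')
        by_cases hφs : q ∈ tsupport φ
        · exact lt_of_lt_of_le hc₀ (hL δ hδ4 t ht q hφs hφθ.le)
        · have he : dampedProfile f φ δ t =ᶠ[𝓝 q] f := by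
            filter_upwards [(isClosed_tsupport φ).isOpen_compl.mem_nhds hφs] with q' hq'
            exact h.dampedProfile_eq_of_notMem δ t hq'
          rw [opL_congr_of_eventuallyEq he]
          exact h.opL_pos q hq (by rw [image_eq_zero_of_notMem_tsupport hφs]; exact zero_ne_one) }

end IsNSIStructure

end Literature.Barriers.NavierStokesRegularity
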